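import Mathlib
import Summits.Ventures.PercRepro2.HCov
import Summits.Ventures.PercRepro2.BHKAvoid
import Summits.Ventures.PercRepro2.ExploreA3
import Summits.Ventures.PercRepro2.RootLeafUSigns
import Summits.Ventures.PercRepro2.RootLeafUCore
import Summits.Ventures.PercRepro2.RootLeafUSepIndep

/-!
# (G4-u) on the mirror separating class, part 1: the root `a₂` cut off from `c` by the attachment
vertex `u` (blind cell PercRepro2, p4 g8; S3 (G4-u), proofs/P4-G8-SEP.md §6)
Setting of `RootLeafUTheorem` / `RootLeafUHalf` (roots `u, a₂`; `L = C(u)`, `K = C(a₂)`,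
`Q = {u ↮ a₂}`; marks `o, c, b`).  The MIRROR separating class is
  **`∀ ω, Conn ω a₂ c → Conn ω a₂ u`**  (every open `a₂–c` connection passes through `u`).
Everything is the `RootLeafUSepIndep` machinery with the roles of `u` and `a₂` exchanged:
* `T = ∅` (`c ∉ K` on `Q`), and `{u ↔ c}` is independent of the cluster of `a₂` under `Q`
  (`SepK.prob_Q_clusterInK_conn_eq`, from `Sep.prob_Q_clusterIn_conn_eq`); hence
  `P(PD, X) = (1 − pc) · P(Q, X)`, `P(T′, X) = pc · P(Q, X)` for `K`-events `X` (`pc = P(u ↔ c)`),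
  and `d0 = P(a₂ ↮ c) = 1 − pc + pc · Z` (`SepK.d0_eq`).
* The side of `o`: either `u` also separates `a₂` from `o` (then `o ∉ K` on `Q`), or `o` lies on
  the `a₂`-side `H = C(a₂)` of `G − u`; there the events `{a₂ ↔ o, a₂ ↔ u}` (edges touching `H`)
  and `{u ↔ c}` (edges not touching `H`) are independent (`SepK.prob_conn_conn_inter_conn_eq`):
  the closure lemma again, through `restrict (touches H)`.
* The switching bound `(1 − Z) · P(Q, oK, bL) ≤ P(a₂ ↔ o, a₂ ↔ u) · P(Q, bL)`
  (`SepK.switch_le`: the tower bound `P(Q, bL, oK) ≤ ho · P(Q, bL)` and Harris).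
Part 2 (`RootLeafUSepKThm`) derives `0 ≤ T2oL`, `0 ≤ T2oK` and the class theorem.
-/

namespace Summit.Ventures.PercRepro2

open UnionCluster CovForm

namespace RootLeafU

namespace SepK

/-! ## Graph part: the `a₂`-side `H` of `G − u`, and `restrict (touches H)` -/

section SepKGraph

variable {V : Type*} {E : Type*} {ends : E → Sym2 V}

/-- `u` is not on the `a₂`-side `H = C(a₂)` of `G − u`. -/
lemma u_notMem_side {u a₂ : V} (hua : u ≠ a₂) :
    u ∉ cluster ends (delConfig ends {u} (fun _ => true : Config E)) a₂ :=
  fun h => hua (Sep.eq_of_conn_delConfig_singleton h).symm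

open Classical in
/-- The cluster of `a₂` in `restrict (touches H) ω` lies inside `H ∪ {u}`
(`H = C(a₂)` in `G − u`). -/
lemma cluster_restrict_subset {u a₂ : V} (hua : u ≠ a₂) (ω : Config E) :
    cluster ends (restrict (touches ends (cluster ends (delConfig ends {u} (fun _ => true : Config E)) a₂)) ω) a₂ ⊆
      cluster ends (delConfig ends {u} (fun _ => true : Config E)) a₂ ∪ {u} := by
  set H := cluster ends (delConfig ends {u} (fun _ => true : Config E)) a₂ with hH
  have huH : u ∉ H := u_notMem_side hua
  intro x hx
  refine mem_of_conn_of_closed (ends := ends) (ω := restrict (touches ends H) ω) ?_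
    (Or.inl (mem_cluster_self ends _ a₂)) hx
  intro y hy z hyz
  obtain ⟨_, e, he, hends⟩ := openGraph_adj.1 hyz
  have heT : e ∈ touches ends H := (restrict_eq_true_iff.1 he).2
  by_cases hz : z = u
  · exact Or.inr hz
  · have hwz : ∀ w ∈ H, w ∈ ends e → w = z ∨ w = y := by
      intro w _ hw
      rw [hends, Sym2.mem_iff] at hw
      exact hw.symm
    rcases hy with hy | hy
    · by_cases hue : u ∈ ends e
      · rw [hends, Sym2.mem_iff] at hue
        rcases hue with hue | hue
        · exact absurd (hue ▸ hy) huH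
        · exact absurd hue.symm hz
      · exact Or.inl (Sep.mem_delCluster_of_adj hy hue hends)
    · rw [Set.mem_singleton_iff] at hy
      subst hy
      obtain ⟨w, hwH, w', hw⟩ := heT
      have hw' : w ∈ ends e := by rw [hw]; exact Sym2.mem_mk_left _ _
      rcases hwz w hwH hw' with rfl | rfl
      · exact Or.inl hwH
      · exact absurd hwH huH

open Classical in
/-- For `x` on the `a₂`-side `H` of `G − u` (or `x = u`), `a₂ ↔ x` only sees the edges touching
`H`: `Conn ω a₂ x ↔ Conn (restrict (touches H) ω) a₂ x`. -/
lemma conn_restrict_iff {u a₂ : V} (hua : u ≠ a₂) {x : V}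
    (hx : x ∈ cluster ends (delConfig ends {u} (fun _ => true : Config E)) a₂ ∪ {u}) (ω : Config E) :
    Conn ends ω a₂ x ↔
      Conn ends (restrict (touches ends (cluster ends (delConfig ends {u} (fun _ => true : Config E)) a₂)) ω) a₂ x := by
  set H := cluster ends (delConfig ends {u} (fun _ => true : Config E)) a₂ with hH
  have huH : u ∉ H := u_notMem_side hua
  constructor
  · intro h
    set ω' := restrict (touches ends H) ω with hω'
    have hsub : cluster ends ω' a₂ ⊆ H ∪ {u} := cluster_restrict_subset hua ω
    have hopen : ∀ {e : E}, ω e = true → e ∈ touches ends H → ω' e = true := fun he heT =>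
      restrict_eq_true_iff.2 ⟨he, heT⟩
    by_cases huC : u ∈ cluster ends ω' a₂
    · have key : x ∈ cluster ends ω' a₂ ∪ Hᶜ := by
        refine mem_of_conn_of_closed (ends := ends) (ω := ω) ?_
          (Or.inl (mem_cluster_self ends _ a₂)) h
        intro y hy z hyz
        obtain ⟨hne, e, he, hends⟩ := openGraph_adj.1 hyz
        rcases hy with hy | hy
        · rcases hsub hy with hyH | hyu
          · exact Or.inl (mem_cluster_of_adj hy (openGraph_adj.2
              ⟨hne, e, hopen he (mem_touches_of_ends hends (Or.inl hyH)), hends⟩))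
          · rw [Set.mem_singleton_iff] at hyu
            by_cases hzH : z ∈ H
            · exact Or.inl (mem_cluster_of_adj hy (openGraph_adj.2
                ⟨hne, e, hopen he (mem_touches_of_ends hends (Or.inr hzH)), hends⟩))
            · exact Or.inr hzH
        · by_cases hzH : z ∈ H
          · have hends' : ends e = s(z, y) := by rw [hends, Sym2.eq_swap]
            by_cases hue : u ∈ ends e
            · rw [hends, Sym2.mem_iff] at hue
              rcases hue with hue | hue
              · subst hue
                exact Or.inl (mem_cluster_of_adj huC (openGraph_adj.2
                  ⟨hne, e, hopen he (mem_touches_of_ends hends (Or.inr hzH)), hends⟩))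
              · exact absurd (hue ▸ hzH) huH
            · exact absurd (Sep.mem_delCluster_of_adj hzH hue hends') hy
          · exact Or.inr hzH
      rcases key with key | key
      · exact key
      · rcases hx with hx | hx
        · exact absurd hx key
        · rw [Set.mem_singleton_iff] at hx
          exact hx ▸ huC
    · refine mem_of_conn_of_closed (ends := ends) (ω := ω) ?_ (mem_cluster_self ends _ a₂) h
      intro y hy z hyz
      obtain ⟨hne, e, he, hends⟩ := openGraph_adj.1 hyz
      rcases hsub hy with hyH | hyu
      · exact mem_cluster_of_adj hy (openGraph_adj.2
          ⟨hne, e, hopen he (mem_touches_of_ends hends (Or.inl hyH)), hends⟩)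
      · rw [Set.mem_singleton_iff] at hyu
        exact absurd (hyu ▸ hy) huC
  · exact conn_mono (restrict_le _ ω)

open Classical in
/-- For `x ∈ H ∪ {u}`, the event `{a₂ ↔ x}` depends only on the edges touching `H`. -/
lemma dependsOn_conn_side {u a₂ : V} (hua : u ≠ a₂) {x : V}
    (hx : x ∈ cluster ends (delConfig ends {u} (fun _ => true : Config E)) a₂ ∪ {u}) :
    DependsOn (· ∈ connEvent ends a₂ x)
      (touches ends (cluster ends (delConfig ends {u} (fun _ => true : Config E)) a₂)) := by
  intro ω ω' h
  have e : restrict (touches ends (cluster ends (delConfig ends {u} (fun _ => true : Config E)) a₂)) ω =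
      restrict (touches ends (cluster ends (delConfig ends {u} (fun _ => true : Config E)) a₂)) ω' := by
    funext e
    by_cases he : e ∈ touches ends (cluster ends (delConfig ends {u} (fun _ => true : Config E)) a₂)
    · rw [restrict_apply_of_mem he, restrict_apply_of_mem he, h e he]
    · rw [restrict_apply_of_notMem he, restrict_apply_of_notMem he]
  show Conn ends ω a₂ x = Conn ends ω' a₂ x
  rw [conn_restrict_iff hua hx ω, conn_restrict_iff hua hx ω', e]

/-- On the mirror class, `{u ↔ c}` depends only on the edges NOT touching `H`. -/
lemma dependsOn_conn_uc {u a₂ c : V} (hsep : ∀ ω : Config E, Conn ends ω a₂ c → Conn ends ω a₂ u)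
    (hua : u ≠ a₂) :
    DependsOn (· ∈ connEvent ends u c)
      (touches ends (cluster ends (delConfig ends {u} (fun _ => true : Config E)) a₂))ᶜ := by
  intro ω ω' h
  have h₀ : ¬ Conn ends (delConfig ends {u} (fun _ => true : Config E)) a₂ u :=
    fun h' => hua (Sep.eq_of_conn_delConfig_singleton h').symm
  have e1 := Sep.conn_delConfig_iff hsep (Ne.symm hua) h₀ ω
  have e2 := Sep.conn_delConfig_iff hsep (Ne.symm hua) h₀ ω'
  have e : delConfig ends (cluster ends (delConfig ends {u} (fun _ => true : Config E)) a₂) ω =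
      delConfig ends (cluster ends (delConfig ends {u} (fun _ => true : Config E)) a₂) ω' :=
    delConfig_congr h
  show Conn ends ω u c = Conn ends ω' u c
  rw [← e1, ← e2, e]

/-- The side of `o`: either `u` separates `a₂` from `o`, or `o` lies on the `a₂`-side of `G − u`. -/
lemma sep_or_mem_side (u a₂ o : V) :
    (∀ ω : Config E, Conn ends ω a₂ o → Conn ends ω a₂ u) ∨
      o ∈ cluster ends (delConfig ends {u} (fun _ => true : Config E)) a₂ := by
  by_cases h : ∀ ω : Config E, Conn ends ω a₂ o → Conn ends ω a₂ u
  · exact Or.inl h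
  · push Not at h
    obtain ⟨ω₀, h1, h2⟩ := h
    exact Or.inr (Sep.cluster_subset_delCluster h2 h1)

end SepKGraph
/-! ## Probabilities: the `c`-side is independent of the cluster of `a₂` under `Q` -/
section SepKProb

variable {V : Type*} {E : Type*} [Fintype E] [DecidableEq E] [Fintype V] [DecidableEq V]
  {R : Type*} [Field R] [LinearOrder R] [IsStrictOrderedRing R]

variable (p : E → R) (ends : E → Sym2 V) (o a₂ c b u : V)

omit [Fintype E] [DecidableEq E] [Fintype V] [DecidableEq V] in
/-- On the mirror class `T = {u ↮ a₂, a₂ ↔ c}` is empty: `c ∉ K` on `Q`. -/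
lemma TEvent_eq_empty (hsep : ∀ ω : Config E, Conn ends ω a₂ c → Conn ends ω a₂ u) :
    TEvent ends u a₂ c = ∅ :=
  Sep.TEvent_swap_eq_empty ends u c a₂ hsep

omit [Fintype E] [DecidableEq E] [Fintype V] [DecidableEq V] in
/-- On the mirror class `PD = Q ∩ {u ↮ c}`. -/
lemma PDEvent_eq (hsep : ∀ ω : Config E, Conn ends ω a₂ c → Conn ends ω a₂ u) :
    PDEvent ends u a₂ c = avoidAll ends a₂ {u} ∩ (connEvent ends u c)ᶜ := by
  rw [avoidAll_singleton_eq ends]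
  ext ω
  simp only [PDEvent, Dtilde, inU, Set.mem_inter_iff, Set.mem_compl_iff, Set.mem_union,
    mem_connEvent, not_or]
  constructor
  · rintro ⟨h1, h2, _⟩
    exact ⟨fun h => h1 (conn_symm h), fun h => h2 (conn_symm h)⟩
  · rintro ⟨h1, h2⟩
    exact ⟨fun h => h1 (conn_symm h), fun h => h2 (conn_symm h),
      fun h => h1 (hsep ω (conn_symm h))⟩

omit [Fintype E] [DecidableEq E] [Fintype V] [DecidableEq V] in
/-- `T′ = Q ∩ {u ↔ c}`. -/
lemma TEvent_swap_eq : TEvent ends a₂ u c = avoidAll ends a₂ {u} ∩ connEvent ends u c := by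
  rw [avoidAll_singleton_eq ends, connEvent_comm ends a₂ u]
  rfl

omit [DecidableEq V] [LinearOrder R] [IsStrictOrderedRing R] in
/-- **Independence of `u ↔ c` from the cluster of `a₂` under `Q`** on the mirror class:
`P(Q, C(a₂) ∈ 𝓥, u ↔ c) = P(u ↔ c) · P(Q, C(a₂) ∈ 𝓥)`. -/
theorem prob_Q_clusterInK_conn_eq (hsep : ∀ ω : Config E, Conn ends ω a₂ c → Conn ends ω a₂ u)
    (hua : u ≠ a₂) (𝓥 : Set (Set V)) :
    prob p (avoidAll ends a₂ {u} ∩ clusterInEvent ends a₂ 𝓥 ∩ connEvent ends u c) =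
      prob p (connEvent ends u c) * prob p (avoidAll ends a₂ {u} ∩ clusterInEvent ends a₂ 𝓥) := by
  have h := Sep.prob_Q_clusterIn_conn_eq p ends u c a₂ hsep (Ne.symm hua) 𝓥
  rwa [Sep.avoidAll_singleton_comm ends a₂ u] at h

omit [DecidableEq V] in
/-- The complementary form: `P(Q, C(a₂) ∈ 𝓥, u ↮ c) = (1 − pc) · P(Q, C(a₂) ∈ 𝓥)`. -/
theorem prob_Q_clusterInK_notConn_eq (hsep : ∀ ω : Config E, Conn ends ω a₂ c → Conn ends ω a₂ u)
    (hua : u ≠ a₂) (𝓥 : Set (Set V)) :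
    prob p (avoidAll ends a₂ {u} ∩ clusterInEvent ends a₂ 𝓥 ∩ (connEvent ends u c)ᶜ) =
      (1 - prob p (connEvent ends u c)) * prob p (avoidAll ends a₂ {u} ∩ clusterInEvent ends a₂ 𝓥) := by
  have h := prob_inter_add_prob_inter_compl p (avoidAll ends a₂ {u} ∩ clusterInEvent ends a₂ 𝓥)
    (connEvent ends u c)
  rw [prob_Q_clusterInK_conn_eq p ends a₂ c u hsep hua 𝓥] at h
  linear_combination h

omit [DecidableEq V] in
/-- `P(PD, C(a₂) ∈ 𝓥) = (1 − pc) · P(Q, C(a₂) ∈ 𝓥)` on the mirror class. -/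
theorem prob_PD_clusterInK_eq (hsep : ∀ ω : Config E, Conn ends ω a₂ c → Conn ends ω a₂ u)
    (hua : u ≠ a₂) (𝓥 : Set (Set V)) :
    prob p (PDEvent ends u a₂ c ∩ clusterInEvent ends a₂ 𝓥) =
      (1 - prob p (connEvent ends u c)) * prob p (avoidAll ends a₂ {u} ∩ clusterInEvent ends a₂ 𝓥) := by
  rw [PDEvent_eq ends a₂ c u hsep, ← prob_Q_clusterInK_notConn_eq p ends a₂ c u hsep hua 𝓥]
  congr 1
  ext ω
  simp only [Set.mem_inter_iff]
  tauto

omit [DecidableEq V] [LinearOrder R] [IsStrictOrderedRing R] in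
/-- `P(T′, C(a₂) ∈ 𝓥) = pc · P(Q, C(a₂) ∈ 𝓥)` on the mirror class. -/
theorem prob_Tp_clusterInK_eq (hsep : ∀ ω : Config E, Conn ends ω a₂ c → Conn ends ω a₂ u)
    (hua : u ≠ a₂) (𝓥 : Set (Set V)) :
    prob p (TEvent ends a₂ u c ∩ clusterInEvent ends a₂ 𝓥) =
      prob p (connEvent ends u c) * prob p (avoidAll ends a₂ {u} ∩ clusterInEvent ends a₂ 𝓥) := by
  rw [TEvent_swap_eq ends a₂ c u, ← prob_Q_clusterInK_conn_eq p ends a₂ c u hsep hua 𝓥]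
  congr 1
  ext ω
  simp only [Set.mem_inter_iff]
  tauto

omit [DecidableEq V] in
/-- `d0 = P(a₂ ↮ c) = 1 − pc + pc · Z` on the mirror class (`a₂ ↔ c` iff `a₂ ↔ u` and `u ↔ c`). -/
theorem d0_eq (hsep : ∀ ω : Config E, Conn ends ω a₂ c → Conn ends ω a₂ u) (hua : u ≠ a₂) :
    prob p (avoidAll ends a₂ {c}) =
      1 - prob p (connEvent ends u c) + prob p (connEvent ends u c) * prob p (avoidAll ends a₂ {u}) := by
  have hset : connEvent ends a₂ c = connEvent ends u c ∩ (avoidAll ends a₂ {u})ᶜ := by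
    rw [avoidAll_singleton_eq ends, compl_compl]
    ext ω
    simp only [Set.mem_inter_iff, mem_connEvent]
    constructor
    · intro h
      exact ⟨conn_trans (conn_symm (hsep ω h)) h, hsep ω h⟩
    · rintro ⟨h1, h2⟩
      exact conn_trans h2 h1
  have h := prob_inter_add_prob_inter_compl p (connEvent ends u c) (avoidAll ends a₂ {u})
  rw [Set.inter_comm] at h
  have h2 := prob_Q_clusterInK_conn_eq p ends a₂ c u hsep hua Set.univ
  rw [clusterInEvent_univ, Set.inter_univ] at h2
  rw [avoidAll_singleton_eq ends a₂ c, prob_compl, hset]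
  linear_combination -h + h2

omit [DecidableEq V] [Fintype V] [LinearOrder R] [IsStrictOrderedRing R] in
/-- **Independence on the `a₂`-side**: for `o ∈ H` (the `a₂`-side of `G − u`),
`P(a₂ ↔ o, a₂ ↔ u, u ↔ c) = P(a₂ ↔ o, a₂ ↔ u) · P(u ↔ c)`. -/
theorem prob_side_inter_conn_eq (hsep : ∀ ω : Config E, Conn ends ω a₂ c → Conn ends ω a₂ u)
    (hua : u ≠ a₂) (ho : o ∈ cluster ends (delConfig ends {u} (fun _ => true : Config E)) a₂) :
    prob p (connEvent ends a₂ o ∩ connEvent ends a₂ u ∩ connEvent ends u c) =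
      prob p (connEvent ends a₂ o ∩ connEvent ends a₂ u) * prob p (connEvent ends u c) := by
  classical
  have hA : DependsOn (· ∈ connEvent ends a₂ o ∩ connEvent ends a₂ u)
      (touches ends (cluster ends (delConfig ends {u} (fun _ => true : Config E)) a₂)) := by
    have h1 := dependsOn_conn_side (ends := ends) hua (x := o) (Or.inl ho)
    have h2 := dependsOn_conn_side (ends := ends) hua (x := u) (Or.inr rfl)
    intro ω ω' h
    exact propext (and_congr (dependsOn_mem_iff h1 h) (dependsOn_mem_iff h2 h))
  exact prob_inter_eq_mul_of_dependsOn p disjoint_compl_right hA (dependsOn_conn_uc hsep hua)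

omit [DecidableEq V] [Fintype V] in
/-- `e0 = P(Q, oK) + (1 − pc) · P(a₂ ↔ o, a₂ ↔ u)` for `o` on the `a₂`-side. -/
theorem e0_eq (hsep : ∀ ω : Config E, Conn ends ω a₂ c → Conn ends ω a₂ u) (hua : u ≠ a₂)
    (ho : o ∈ cluster ends (delConfig ends {u} (fun _ => true : Config E)) a₂) :
    prob p (avoidAll ends a₂ {c} ∩ connEvent ends a₂ o) =
      prob p (avoidAll ends a₂ {u} ∩ connEvent ends a₂ o) +
        (1 - prob p (connEvent ends u c)) * prob p (connEvent ends a₂ o ∩ connEvent ends a₂ u) := by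
  have hset : connEvent ends a₂ o ∩ connEvent ends a₂ c =
      connEvent ends a₂ o ∩ connEvent ends a₂ u ∩ connEvent ends u c := by
    ext ω
    simp only [Set.mem_inter_iff, mem_connEvent]
    constructor
    · rintro ⟨h1, h2⟩
      exact ⟨⟨h1, hsep ω h2⟩, conn_trans (conn_symm (hsep ω h2)) h2⟩
    · rintro ⟨⟨h1, h2⟩, h3⟩
      exact ⟨h1, conn_trans h2 h3⟩
  have h1 := prob_inter_add_prob_inter_compl p (connEvent ends a₂ o) (connEvent ends a₂ c)
  have h2 := prob_inter_add_prob_inter_compl p (connEvent ends a₂ o) (connEvent ends a₂ u)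
  rw [hset, prob_side_inter_conn_eq p ends o a₂ c u hsep hua ho] at h1
  rw [avoidAll_singleton_eq ends a₂ c, avoidAll_singleton_eq ends a₂ u, Set.inter_comm,
    Set.inter_comm (connEvent ends a₂ u)ᶜ]
  linear_combination h1 - h2

omit [DecidableEq V] in
/-- The tower bound with the `L`-event `b ∈ L` and the `K`-event `o ∈ K` under `Q`:
`P(Q, bL, oK) ≤ ho · P(Q, bL)`. -/
lemma prob_Q_bL_oK_le_ho (hp : IsProbVec p) :
    prob p (avoidAll ends a₂ {u} ∩ connEvent ends u b ∩ connEvent ends a₂ o) ≤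
      prob p (connEvent ends a₂ o) * prob p (avoidAll ends a₂ {u} ∩ connEvent ends u b) := by
  classical
  have ha2 : a₂ ∈ ({a₂} : Finset V) := by simp
  have tB := prob_clusterIn_inter_avoid_eq_expect p ends u a₂ ha2 {W | b ∈ W} {W | o ∈ W}
  have t1 := prob_clusterIn_inter_avoid_eq_expect p ends u a₂ ha2 {W | b ∈ W} Set.univ
  have hg1 : ∀ K, delClusterProb p ends a₂ Set.univ K = 1 := delClusterProb_univ p ends a₂
  simp only [clusterInEvent_univ, Set.inter_univ, hg1, mul_one] at t1
  rw [ExploreA3.clusterInEvent_mem_eq, ExploreA3.clusterInEvent_mem_eq] at tB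
  rw [ExploreA3.clusterInEvent_mem_eq] at t1
  have e1 : connEvent ends u b ∩ connEvent ends a₂ o ∩ avoidAll ends u {a₂} =
      avoidAll ends a₂ {u} ∩ connEvent ends u b ∩ connEvent ends a₂ o := by
    rw [Sep.avoidAll_singleton_comm ends a₂ u]
    ext ω
    simp only [Set.mem_inter_iff]
    tauto
  have e2 : connEvent ends u b ∩ avoidAll ends u {a₂} = avoidAll ends a₂ {u} ∩ connEvent ends u b := by
    rw [Sep.avoidAll_singleton_comm ends a₂ u, Set.inter_comm]
  rw [e1] at tB
  rw [e2] at t1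
  rw [tB, t1, ← expect_const_mul]
  refine expect_mono hp fun ω => ?_
  have h1 : delClusterProb p ends a₂ {W | o ∈ W} (cluster ends ω u) ≤
      prob p (connEvent ends a₂ o) := delClusterProb_mem_le p ends hp a₂ o _
  have h2 : (0 : R) ≤ ({W : Set V | b ∈ W}).indicator 1 (cluster ends ω u) :=
    Set.indicator_apply_nonneg fun _ => zero_le_one
  have h3 : (0 : R) ≤ (avoidAll ends u {a₂}).indicator 1 ω :=
    Set.indicator_apply_nonneg fun _ => zero_le_one
  calc ({W : Set V | b ∈ W}).indicator 1 (cluster ends ω u) *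
        delClusterProb p ends a₂ {W | o ∈ W} (cluster ends ω u) * (avoidAll ends u {a₂}).indicator 1 ω
      ≤ ({W : Set V | b ∈ W}).indicator 1 (cluster ends ω u) * prob p (connEvent ends a₂ o) *
        (avoidAll ends u {a₂}).indicator 1 ω :=
        mul_le_mul_of_nonneg_right (mul_le_mul_of_nonneg_left h1 h2) h3
    _ = prob p (connEvent ends a₂ o) * (({W : Set V | b ∈ W}).indicator 1 (cluster ends ω u) *
        (avoidAll ends u {a₂}).indicator 1 ω) := by ring

omit [DecidableEq V] in
/-- **The switching bound** `(1 − Z) · P(Q, bL, oK) ≤ P(a₂ ↔ o, a₂ ↔ u) · P(Q, bL)`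
(tower bound + Harris). -/
theorem switch_le (hp : IsProbVec p) :
    (1 - prob p (avoidAll ends a₂ {u})) *
        prob p (avoidAll ends a₂ {u} ∩ connEvent ends u b ∩ connEvent ends a₂ o) ≤
      prob p (connEvent ends a₂ o ∩ connEvent ends a₂ u) *
        prob p (avoidAll ends a₂ {u} ∩ connEvent ends u b) := by
  have h1 := prob_Q_bL_oK_le_ho p ends o a₂ b u hp
  have h2 : prob p (connEvent ends a₂ o) * prob p (connEvent ends a₂ u) ≤
      prob p (connEvent ends a₂ o ∩ connEvent ends a₂ u) :=
    prob_mul_prob_le_prob_inter hp (isUpperSet_connEvent ends a₂ o) (isUpperSet_connEvent ends a₂ u)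
  have hZ : 1 - prob p (avoidAll ends a₂ {u}) = prob p (connEvent ends a₂ u) := by
    rw [avoidAll_singleton_eq ends, prob_compl]
    ring
  have h0 : 0 ≤ prob p (avoidAll ends a₂ {u} ∩ connEvent ends u b) := prob_nonneg hp _
  have h0' : 0 ≤ prob p (connEvent ends a₂ u) := prob_nonneg hp _
  rw [hZ]
  calc prob p (connEvent ends a₂ u) *
        prob p (avoidAll ends a₂ {u} ∩ connEvent ends u b ∩ connEvent ends a₂ o)
      ≤ prob p (connEvent ends a₂ u) *
        (prob p (connEvent ends a₂ o) * prob p (avoidAll ends a₂ {u} ∩ connEvent ends u b)) :=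
        mul_le_mul_of_nonneg_left h1 h0'
    _ = (prob p (connEvent ends a₂ o) * prob p (connEvent ends a₂ u)) *
        prob p (avoidAll ends a₂ {u} ∩ connEvent ends u b) := by ring
    _ ≤ prob p (connEvent ends a₂ o ∩ connEvent ends a₂ u) *
        prob p (avoidAll ends a₂ {u} ∩ connEvent ends u b) := mul_le_mul_of_nonneg_right h2 h0

end SepKProb

end SepK

end RootLeafU

end Summit.Ventures.PercRepro2
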